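/-
Copyright (c) 2026. All rights reserved.
Released under Apache 2.0 license as described in the file LICENSE.
Authors: abc-iut cell, campaign-S prover seat abc-iut-S1 (wave 1, gen 7).
-/
import Summits.ABC.IUTFork.Cor312Ind3IteratesVacuityWildDyadic
import Literature.IUT.LogVolume.UnitLogWildDyadicQuarticGaussian
import HarnessLib

/-!
# (Ind3) honest iterates at the dyadic places with `(e, f) = (4, 1)`: EMPTY when `√−1 ∈ F`; both answers otherwise

Proof-only sequel (theorems, no definitions) of the honest-model census of the [IUTchIII] log-link iterates
(`Real.nonarchIterImage (analyticLogv F) v m′`, abc-iut-w4-d029 / abc-iut-c312-5; dyadic pattern file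
`Cor312Ind3IteratesVacuityWildDyadic.lean`, abc-iut-w5-d172).  Census of record at `v ∣ 2` (abc-iut-w5-d017,
kernel): EMPTY if `e(v|2)` is odd or `f(v|2) = 1 ∧ e(v|2) ≡ 2 (mod 4)`; INHABITED at depth `2` if
`2 ∣ e(v|2) ∧ f(v|2) ≥ 2`; «`f(v|2) = 1 ∧ 4 ∣ e(v|2)` undecided».  This file transports abc-iut-S1's local
results on the class `(e, f) = (4, 1)` (`Literature.IUT.LogVolume.WildDyadicQuartic.*`, classical) to the
completions `F_v` through abc-iut-S7's rescaled completion: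

* `Real.nonarchIterImage_add_two_eq_empty_of_quartic_of_sq_eq_neg_one` — **`√−1 ∈ F` (as in [IUTchI]
  Def. 3.1), `v ∣ 2`, `e(v|2) = 4`, `f(v|2) = 1` ⇒ every honest depth-`≥ 2` image at `v` is EMPTY**
  (local input: `logUnits_inter_sphere_eq_empty_of_four_of_sq_eq_neg_one`, torsion–power criterion +
  Artin–Schreier); column level `Column.unitImage_add_two_eq_empty_of_honestImages_of_quartic_gaussian`.
* `Real.nonarchIterImage_analyticLogv_two_nonempty_of_pow_four_eq` — **`F ∋ θ` with `θ⁴ = m`,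
  `m ≡ 3, 5 (mod 8)` (e.g. `F ⊇ ℚ(⁴√3)`), `v ∣ 2` ⇒ the depth-`2` image at `v` is INHABITED** (no hypothesis
  on `e, f`; local input: the witness lemma `‖ζu⁴ − 1‖ = ‖4‖ ⇒ ‖log₂ u‖ = 1`).
* `Real.nonarchIterImage_add_two_eq_empty_of_quartic_of_pow_four_eq_two` — **`F ∋ ϖ₀`, `ϖ₀⁴ = 2`,
  `v ∣ 2`, `(e, f)(v) = (4, 1)` ⇒ EMPTY**.
* F-level: `exists_numberField_quartic_dyadic_two_nonempty` (`ℚ(⁴√3)`: a place over `2` with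
  `(e, f) = (4, 1)` and INHABITED depth `2`) and `exists_numberField_quartic_dyadic_eq_empty` (`ℚ(⁴√2)`:
  `(e, f) = (4, 1)`, EMPTY) — **the census bit at `(e, f) = (4, 1)` is NOT a function of `(e, f)`**
  (`exists_quartic_dyadic_pair`), while for fields containing `√−1` it is: EMPTY.

Honest framing: statements ABOUT THE MODEL (which typed (Ind3) containments are `∅ ⊆ _`); classical local
arithmetic underneath (Neukirch II (5.5), Koblitz IV §1–2); nothing here asserts or denies [IUTchIII] Cor. 3.12
or takes a side; census ≠ verdict; typed ≠ proved.  No definitions, no Prop-valued fact (D-0067 (1)).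
-/

noncomputable section

open Set

namespace Summit.ABC.IUTFork.Thm311.Real

open NumberField IsDedekindDomain Literature.IUT.LogVolume Literature.IUT.LogThetaLattice
  Literature.NumberTheory.NumberFields Polynomial

variable {F : Type} [Field F] [NumberField F]

/-! ## 1. `√−1 ∈ F`, `(e, f)(v|2) = (4, 1)`: depth `≥ 2` is empty -/

/-- In the rescaled completion at a place over `p = 2` with `e(v|2) = 4`, `f(v|2) = 1`, containing a square root
of `−1`, no `unitLog` value has norm `1` (abc-iut-S1's
`WildDyadicQuartic.norm_unitLog_ne_one_of_four_of_sq_eq_neg_one` + abc-iut-S7's `e(F_v) = e(v|p)`,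
`f(F_v) = f(v|p)`). [cite: Koblitz1984, Ch. IV §2] -/
theorem norm_rescaled_unitLog_ne_one_of_quartic_gaussian (v : HeightOneSpectrum (𝓞 F)) (p : ℕ) [Fact p.Prime]
    (hv : ((p : ℕ) : 𝓞 F) ∈ v.asIdeal) (hp2 : p = 2) (he : v.asIdeal.ramificationIdx ℤ = 4)
    (hf : v.asIdeal.inertiaDeg ℤ = 1) {i : RescaledCompletion F p v hv} (hi : i ^ 2 = -1)
    (x : RescaledCompletion F p v hv) : ‖unitLog x‖ ≠ 1 := by
  subst hp2
  have he' : absRamificationIdx 2 (RescaledCompletion F 2 v hv) = 4 := by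
    rw [absRamificationIdx_rescaledCompletion, he]
  have hf' : residueDegree 2 (RescaledCompletion F 2 v hv) = 1 := by
    rw [residueDegree_rescaledCompletion, hf]
  exact WildDyadicQuartic.norm_unitLog_ne_one_of_four_of_sq_eq_neg_one he' hf' hi x

/-- **`F ∋ i`, `i² = −1`; `v ∣ 2` with `e(v|2) = 4`, `f(v|2) = 1` ⇒ the analytic logarithm of a unit of `O_v`
is never a unit of `O_v`.** [cite: Koblitz1984, Ch. IV §2] -/
theorem analyticLogv_ne_coe_unit_of_quartic_gaussian (v : HeightOneSpectrum (𝓞 F))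
    (h2 : ((2 : ℕ) : 𝓞 F) ∈ v.asIdeal) (he : v.asIdeal.ramificationIdx ℤ = 4) (hf : v.asIdeal.inertiaDeg ℤ = 1)
    {i : F} (hi : i ^ 2 = -1) (w u : (↥(integers v))ˣ) :
    analyticLogv F v (Additive.ofMul w) ≠ ((u : ↥(integers v)) : Carrier (.inr v : Place F)) := by
  haveI : Fact (residueChar F v).Prime := ⟨residueChar_prime F v⟩
  have hp : residueChar F v = 2 := residueChar_eq_of_prime_natCast_mem v Nat.prime_two h2
  have hi' : (RescaledCompletion.of F (residueChar F v) v (natCast_residueChar_mem F v)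
      (algebraMap F (v.adicCompletion F) i)) ^ 2 = -1 := by
    rw [← map_pow, ← map_pow, hi, map_neg, map_one, map_neg, map_one]
  intro h
  have h1 := norm_rescaled_unitLog_ne_one_of_quartic_gaussian v (residueChar F v) (natCast_residueChar_mem F v)
    hp he hf hi' (RescaledCompletion.of F (residueChar F v) v (natCast_residueChar_mem F v)
      ((w : ↥(integers v)) : Carrier (.inr v : Place F)))
  apply h1
  have h' := congrArg (RescaledCompletion.of F (residueChar F v) v (natCast_residueChar_mem F v)) h
  rw [analyticLogv_apply, RingEquiv.apply_symm_apply] at h'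
  rw [h']
  exact norm_of_coe_unit_adicCompletionIntegers F (residueChar F v) v (natCast_residueChar_mem F v) u

/-- **`√−1 ∈ F`, `v ∣ 2`, `(e, f)(v|2) = (4, 1)` ⇒ the honest (Ind3) iterate image of EVERY depth `≥ 2` at `v`
is EMPTY** — the `(4, 1)` case of the census for the fields of [IUTchI] Def. 3.1 (which contain `√−1`).
[claim: Mochizuki2012, status: disputed] -/
theorem nonarchIterImage_add_two_eq_empty_of_quartic_of_sq_eq_neg_one (v : HeightOneSpectrum (𝓞 F))
    (h2 : ((2 : ℕ) : 𝓞 F) ∈ v.asIdeal) (he : v.asIdeal.ramificationIdx ℤ = 4) (hf : v.asIdeal.inertiaDeg ℤ = 1)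
    {i : F} (hi : i ^ 2 = -1) (k : ℕ) : nonarchIterImage (analyticLogv F) v (k + 2) = ∅ :=
  nonarchIterImage_add_two_eq_empty_of_forall_ne (analyticLogv F) v
    (fun w u => analyticLogv_ne_coe_unit_of_quartic_gaussian v h2 he hf hi w u) k

/-- … for every depth `m′ ≥ 2`. [claim: Mochizuki2012, status: disputed] -/
theorem nonarchIterImage_eq_empty_of_two_le_of_quartic_of_sq_eq_neg_one (v : HeightOneSpectrum (𝓞 F))
    (h2 : ((2 : ℕ) : 𝓞 F) ∈ v.asIdeal) (he : v.asIdeal.ramificationIdx ℤ = 4) (hf : v.asIdeal.inertiaDeg ℤ = 1)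
    {i : F} (hi : i ^ 2 = -1) {m' : ℕ} (hm' : 2 ≤ m') : nonarchIterImage (analyticLogv F) v m' = ∅ := by
  obtain ⟨k, rfl⟩ := Nat.exists_eq_add_of_le' hm'
  exact nonarchIterImage_add_two_eq_empty_of_quartic_of_sq_eq_neg_one v h2 he hf hi k

/-- **Column level.** For pilot data `X` over a field `F ∋ √−1` and ANY column over
`Real.logShellsDH X (analyticLogv F)` with honest unit images: at a place `w ∣ 2` of the fibre with
`(e, f)(w|2) = (4, 1)` the unit image at `(m, m′ + 2, j, v_ℚ)` is `∅`, so (Ind3) there reads `∅ ⊆ _`.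
[claim: Mochizuki2012, status: disputed] -/
theorem _root_.Summit.ABC.IUTFork.Thm311.Column.unitImage_add_two_eq_empty_of_honestImages_of_quartic_gaussian
    (X : PilotData F) (C : Column (logShellsDH X (analyticLogv F)))
    (hunit : ∀ (m : ℤ) (m' : ℕ) (j : (thetaIndex X).Label) (vQ : (thetaIndex X).VQ),
      C.unitImage m m' j vQ =
        (logShellsDH X (analyticLogv F)).tprodImages j vQ (honestU X (analyticLogv F) m m' vQ))
    {i : F} (hi : i ^ 2 = -1) (m : ℤ) (k : ℕ) (j : (thetaIndex X).Label) {vQ : (thetaIndex X).VQ}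
    (w : HeightOneSpectrum (𝓞 F)) (hw : (thetaIndex X).over (.inr w) = vQ)
    (h2 : ((2 : ℕ) : 𝓞 F) ∈ w.asIdeal) (he : w.asIdeal.ramificationIdx ℤ = 4) (hf : w.asIdeal.inertiaDeg ℤ = 1) :
    C.unitImage m (k + 2) j vQ = ∅ := by
  rw [hunit]
  exact LogShells.tprodImages_eq_empty_of_eq_empty _ j vQ _ ⟨.inr w, hw⟩
    (nonarchIterImage_add_two_eq_empty_of_quartic_of_sq_eq_neg_one w h2 he hf hi k)

/-! ## 2. `F ∋ θ`, `θ⁴ = m ≡ 3, 5 (mod 8)`: depth `2` is inhabited at every `v ∣ 2` -/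

/-- In the rescaled completion at a place over `2`: `θ⁴ = m`, `m ≡ 3, 5 (mod 8)` ⇒ `‖θ‖ = 1` and
`‖log₂ θ‖ = 1` (abc-iut-S1's `WildDyadicQuartic.norm_unitLog_eq_one_of_pow_four_eq_natCast`).
[cite: NeukirchANT1999, Ch. II (5.5)] -/
theorem norm_rescaled_unitLog_eq_one_of_pow_four_eq (v : HeightOneSpectrum (𝓞 F)) (p : ℕ) [Fact p.Prime]
    (hv : ((p : ℕ) : 𝓞 F) ∈ v.asIdeal) (hp2 : p = 2) {m : ℕ} (hm : m % 8 = 3 ∨ m % 8 = 5)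
    {θ : RescaledCompletion F p v hv} (hθ : θ ^ 4 = m) : ‖θ‖ = 1 ∧ ‖unitLog θ‖ = 1 := by
  subst hp2
  have hmK : ‖(m : RescaledCompletion F 2 v hv)‖ = 1 := norm_natCast_eq_one_of_not_dvd 2 (by omega)
  have hθ1 : ‖θ‖ = 1 := by
    have h1 : ‖θ‖ ^ 4 = 1 := by rw [← norm_pow, hθ, hmK]
    exact (pow_eq_one_iff_of_nonneg (norm_nonneg θ) (by norm_num)).mp h1
  exact ⟨hθ1, WildDyadicQuartic.norm_unitLog_eq_one_of_pow_four_eq_natCast hθ hm⟩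

/-- **`F ∋ θ` with `θ⁴ = m`, `m ≡ 3, 5 (mod 8)` (e.g. `⁴√3`, `⁴√5`, `⁴√11`), `v ∣ 2` ⇒ the honest depth-`2`
(Ind3) iterate image at `v` is NONEMPTY**: `θ ∈ O_v^×` has `log_v(θ) ∈ O_v^×`, so `log_v(log_v(θ))` is a
depth-`2` element. [claim: Mochizuki2012, status: disputed] -/
theorem nonarchIterImage_analyticLogv_two_nonempty_of_pow_four_eq (v : HeightOneSpectrum (𝓞 F))
    (h2 : ((2 : ℕ) : 𝓞 F) ∈ v.asIdeal) {m : ℕ} (hm : m % 8 = 3 ∨ m % 8 = 5) {θ : F} (hθ : θ ^ 4 = m) :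
    (nonarchIterImage (analyticLogv F) v 2).Nonempty := by
  haveI : Fact (residueChar F v).Prime := ⟨residueChar_prime F v⟩
  have hp : residueChar F v = 2 := residueChar_eq_of_prime_natCast_mem v Nat.prime_two h2
  set y : v.adicCompletion F := algebraMap F (v.adicCompletion F) θ with hy
  have hθ' : (RescaledCompletion.of F (residueChar F v) v (natCast_residueChar_mem F v) y) ^ 4 = m := by
    rw [← map_pow, hy, ← map_pow, hθ, map_natCast, map_natCast]
  obtain ⟨hy1, hylog⟩ := norm_rescaled_unitLog_eq_one_of_pow_four_eq v (residueChar F v)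
    (natCast_residueChar_mem F v) hp hm hθ'
  obtain ⟨w, hw⟩ := exists_unit_coe_eq_of_norm_rescaled_eq_one v (residueChar F v)
    (natCast_residueChar_mem F v) y hy1
  have hlog : ‖RescaledCompletion.of F (residueChar F v) v (natCast_residueChar_mem F v)
      (analyticLogv F v (Additive.ofMul w))‖ = 1 := by
    rw [analyticLogv_apply, RingEquiv.apply_symm_apply, hw]
    exact hylog
  obtain ⟨u, hu⟩ := exists_unit_coe_eq_of_norm_rescaled_eq_one v (residueChar F v)
    (natCast_residueChar_mem F v) (analyticLogv F v (Additive.ofMul w)) hlog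
  exact nonarchIterImage_two_nonempty_of_exists_eq_coe_unit (analyticLogv F) v ⟨w, u, hu.symm⟩

/-- … in particular for `θ⁴ = 3`. [claim: Mochizuki2012, status: disputed] -/
theorem nonarchIterImage_analyticLogv_two_nonempty_of_pow_four_eq_three (v : HeightOneSpectrum (𝓞 F))
    (h2 : ((2 : ℕ) : 𝓞 F) ∈ v.asIdeal) {θ : F} (hθ : θ ^ 4 = 3) :
    (nonarchIterImage (analyticLogv F) v 2).Nonempty :=
  nonarchIterImage_analyticLogv_two_nonempty_of_pow_four_eq v h2 (m := 3) (Or.inl rfl) (by rw [hθ]; norm_cast)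

/-! ## 3. `F ∋ ϖ₀`, `ϖ₀⁴ = 2`, `(e, f)(v|2) = (4, 1)`: depth `≥ 2` is empty -/

/-- In the rescaled completion at a place over `p = 2` with `(e, f)(v|2) = (4, 1)` containing a fourth root of
`2`, no `unitLog` value has norm `1` (abc-iut-S1's `WildDyadicQuartic.norm_unitLog_ne_one_of_four` with
`‖ϖ₀⁴ − 2‖ = 0 ≤ ‖4‖`). [cite: NeukirchANT1999, Ch. II (5.5)] -/
theorem norm_rescaled_unitLog_ne_one_of_quartic_of_pow_four_eq_two (v : HeightOneSpectrum (𝓞 F)) (p : ℕ)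
    [Fact p.Prime] (hv : ((p : ℕ) : 𝓞 F) ∈ v.asIdeal) (hp2 : p = 2) (he : v.asIdeal.ramificationIdx ℤ = 4)
    (hf : v.asIdeal.inertiaDeg ℤ = 1) {ϖ : RescaledCompletion F p v hv} (hϖ : ϖ ^ 4 = 2)
    (x : RescaledCompletion F p v hv) : ‖unitLog x‖ ≠ 1 := by
  subst hp2
  have he' : absRamificationIdx 2 (RescaledCompletion F 2 v hv) = 4 := by
    rw [absRamificationIdx_rescaledCompletion, he]
  have hf' : residueDegree 2 (RescaledCompletion F 2 v hv) = 1 := by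
    rw [residueDegree_rescaledCompletion, hf]
  have hϖ' : ‖ϖ ^ 4 - 2‖ ≤ ‖(4 : RescaledCompletion F 2 v hv)‖ := by
    rw [hϖ, sub_self, norm_zero]; exact norm_nonneg _
  exact WildDyadicQuartic.norm_unitLog_ne_one_of_four he' hf' hϖ' x

/-- **`F ∋ ϖ₀` with `ϖ₀⁴ = 2` (e.g. `F ⊇ ℚ(⁴√2)`); `v ∣ 2` with `e(v|2) = 4`, `f(v|2) = 1` ⇒ the analytic
logarithm of a unit of `O_v` is never a unit.** [cite: NeukirchANT1999, Ch. II (5.5)] -/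
theorem analyticLogv_ne_coe_unit_of_quartic_of_pow_four_eq_two (v : HeightOneSpectrum (𝓞 F))
    (h2 : ((2 : ℕ) : 𝓞 F) ∈ v.asIdeal) (he : v.asIdeal.ramificationIdx ℤ = 4) (hf : v.asIdeal.inertiaDeg ℤ = 1)
    {ϖ₀ : F} (hϖ₀ : ϖ₀ ^ 4 = 2) (w u : (↥(integers v))ˣ) :
    analyticLogv F v (Additive.ofMul w) ≠ ((u : ↥(integers v)) : Carrier (.inr v : Place F)) := by
  haveI : Fact (residueChar F v).Prime := ⟨residueChar_prime F v⟩
  have hp : residueChar F v = 2 := residueChar_eq_of_prime_natCast_mem v Nat.prime_two h2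
  have hϖ' : (RescaledCompletion.of F (residueChar F v) v (natCast_residueChar_mem F v)
      (algebraMap F (v.adicCompletion F) ϖ₀)) ^ 4 = 2 := by
    rw [← map_pow, ← map_pow, hϖ₀, map_ofNat, map_ofNat]
  intro h
  have h1 := norm_rescaled_unitLog_ne_one_of_quartic_of_pow_four_eq_two v (residueChar F v)
    (natCast_residueChar_mem F v) hp he hf hϖ' (RescaledCompletion.of F (residueChar F v) v
      (natCast_residueChar_mem F v) ((w : ↥(integers v)) : Carrier (.inr v : Place F)))
  apply h1
  have h' := congrArg (RescaledCompletion.of F (residueChar F v) v (natCast_residueChar_mem F v)) h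
  rw [analyticLogv_apply, RingEquiv.apply_symm_apply] at h'
  rw [h']
  exact norm_of_coe_unit_adicCompletionIntegers F (residueChar F v) v (natCast_residueChar_mem F v) u

/-- **`F ∋ ϖ₀`, `ϖ₀⁴ = 2`; `v ∣ 2`, `(e, f)(v|2) = (4, 1)` ⇒ every honest depth-`≥ 2` image at `v` is EMPTY.**
[claim: Mochizuki2012, status: disputed] -/
theorem nonarchIterImage_add_two_eq_empty_of_quartic_of_pow_four_eq_two (v : HeightOneSpectrum (𝓞 F))
    (h2 : ((2 : ℕ) : 𝓞 F) ∈ v.asIdeal) (he : v.asIdeal.ramificationIdx ℤ = 4) (hf : v.asIdeal.inertiaDeg ℤ = 1)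
    {ϖ₀ : F} (hϖ₀ : ϖ₀ ^ 4 = 2) (k : ℕ) : nonarchIterImage (analyticLogv F) v (k + 2) = ∅ :=
  nonarchIterImage_add_two_eq_empty_of_forall_ne (analyticLogv F) v
    (fun w u => analyticLogv_ne_coe_unit_of_quartic_of_pow_four_eq_two v h2 he hf hϖ₀ w u) k

/-! ## 4. F-level: `ℚ(⁴√3)` and `ℚ(⁴√2)` — the census bit at `(e, f) = (4, 1)` is not a function of `(e, f)` -/

/-- In the rescaled completion at a place over `p = 2`: `‖x‖⁴ = 1/2 ⇒ 4 ≤ e` (`‖x‖ < 1 ⇒ ‖x‖ ≤ 2^{−1/e}`).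
[cite: NeukirchANT1999, Ch. II (5.5)] -/
theorem four_le_absRamificationIdx_rescaled_of_norm_pow_four (v : HeightOneSpectrum (𝓞 F)) (p : ℕ) [Fact p.Prime]
    (hv : ((p : ℕ) : 𝓞 F) ∈ v.asIdeal) (hp2 : p = 2) (x : RescaledCompletion F p v hv)
    (hnorm : ‖x‖ ^ 4 = 2⁻¹) : 4 ≤ absRamificationIdx p (RescaledCompletion F p v hv) := by
  subst hp2
  have hxlt : ‖x‖ < 1 :=
    (pow_lt_one_iff_of_nonneg (norm_nonneg _) (by norm_num : (4 : ℕ) ≠ 0)).mp (by rw [hnorm]; norm_num)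
  have hdisc := norm_le_rpow_of_norm_lt_one 2 (RescaledCompletion F 2 v hv) hxlt
  set e := absRamificationIdx 2 (RescaledCompletion F 2 v hv) with hedef
  have he0 : (0 : ℝ) < e := by exact_mod_cast absRamificationIdx_pos 2 (RescaledCompletion F 2 v hv)
  have h4 : ‖x‖ ^ 4 ≤ ((2 : ℝ) ^ (-(1 / (e : ℝ)))) ^ 4 := pow_le_pow_left₀ (norm_nonneg _) hdisc 4
  rw [hnorm, ← Real.rpow_natCast, ← Real.rpow_mul (by norm_num), ← Real.rpow_neg_one,
    Real.rpow_le_rpow_left_iff (by norm_num : (1 : ℝ) < 2)] at h4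
  have hege : (4 : ℝ) ≤ e := by
    have h := mul_le_mul_of_nonneg_right h4 he0.le
    field_simp at h
    push_cast at h
    nlinarith
  exact_mod_cast hege

/-- **`θ⁴ = 3` in `K_v`, `2 ∈ 𝔭_v` ⇒ `4 ≤ e(v|2)`**: `(θ − 1)⁴ = 6θ² − 4θ(1 + θ²)` has norm `‖2‖`.
[cite: NeukirchANT1999, Ch. II (5.5)] -/
theorem four_le_ramificationIdx_of_pow_four_eq_three (v : HeightOneSpectrum (𝓞 F))
    (h2 : ((2 : ℕ) : 𝓞 F) ∈ v.asIdeal) (x : v.adicCompletion F) (hx : x ^ 4 = 3) :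
    4 ≤ v.asIdeal.ramificationIdx ℤ := by
  set θ : RescaledCompletion F 2 v h2 := RescaledCompletion.of F 2 v h2 x with hθdef
  have hθ : θ ^ 4 = 3 := by rw [hθdef, ← map_pow, hx, map_ofNat]
  have h3n : ‖(3 : RescaledCompletion F 2 v h2)‖ = 1 := by
    exact_mod_cast norm_natCast_eq_one_of_not_dvd 2 (K := RescaledCompletion F 2 v h2) (m := 3) (by norm_num)
  have hθ1 : ‖θ‖ = 1 := by
    have h1 : ‖θ‖ ^ 4 = 1 := by rw [← norm_pow, hθ, h3n]
    exact (pow_eq_one_iff_of_nonneg (norm_nonneg θ) (by norm_num)).mp h1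
  have hid : (θ - 1) ^ 4 = 6 * θ ^ 2 + 4 * (1 - θ - θ ^ 3) := by
    have hexp : (θ - 1) ^ 4 = θ ^ 4 - 4 * θ ^ 3 + 6 * θ ^ 2 - 4 * θ + 1 := by ring
    rw [hexp, hθ]
    ring
  have h6 : ‖(6 : RescaledCompletion F 2 v h2) * θ ^ 2‖ = 2⁻¹ := by
    rw [norm_mul, show (6 : RescaledCompletion F 2 v h2) = 2 * 3 by norm_num, norm_mul, WildDyadic.norm_two,
      h3n, norm_pow, hθ1]
    norm_num
  have hult : ∀ a b : RescaledCompletion F 2 v h2, ‖a‖ ≤ 1 → ‖b‖ ≤ 1 → ‖a + b‖ ≤ 1 := fun a b ha hb =>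
    (IsUltrametricDist.norm_add_le_max a b).trans (max_le ha hb)
  have hsmall : ‖(4 : RescaledCompletion F 2 v h2) * (1 - θ - θ ^ 3)‖ ≤ 4⁻¹ := by
    rw [norm_mul, UnramifiedDyadic.norm_four]
    have h1 : ‖1 - θ - θ ^ 3‖ ≤ 1 := by
      rw [show (1 : RescaledCompletion F 2 v h2) - θ - θ ^ 3 = 1 + (-θ + -(θ ^ 3)) by ring]
      refine hult _ _ (by rw [norm_one]) (hult _ _ ?_ ?_)
      · rw [norm_neg, hθ1]
      · rw [norm_neg, norm_pow, hθ1, one_pow]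
    calc (4⁻¹ : ℝ) * ‖1 - θ - θ ^ 3‖ ≤ 4⁻¹ * 1 := by gcongr
      _ = 4⁻¹ := mul_one _
  have hnorm : ‖θ - 1‖ ^ 4 = 2⁻¹ := by
    rw [← norm_pow, hid]
    have hlt : ‖(4 : RescaledCompletion F 2 v h2) * (1 - θ - θ ^ 3)‖
        < ‖(6 : RescaledCompletion F 2 v h2) * θ ^ 2‖ := by
      rw [h6]; exact hsmall.trans_lt (by norm_num)
    rw [IsUltrametricDist.norm_add_eq_max_of_norm_ne_norm (ne_of_gt hlt), max_eq_left hlt.le, h6]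
  have h := four_le_absRamificationIdx_rescaled_of_norm_pow_four v 2 h2 rfl (θ - 1) hnorm
  rwa [absRamificationIdx_rescaledCompletion] at h

/-- **`x⁴ = 2` in `K_v`, `2 ∈ 𝔭_v` ⇒ `4 ≤ e(v|2)`** (`‖x‖⁴ = 1/2`). [cite: NeukirchANT1999, Ch. II (5.5)] -/
theorem four_le_ramificationIdx_of_pow_four_eq_two (v : HeightOneSpectrum (𝓞 F))
    (h2 : ((2 : ℕ) : 𝓞 F) ∈ v.asIdeal) (x : v.adicCompletion F) (hx : x ^ 4 = 2) :
    4 ≤ v.asIdeal.ramificationIdx ℤ := by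
  have h := four_le_absRamificationIdx_rescaled_of_norm_pow_four v 2 h2 rfl (RescaledCompletion.of F 2 v h2 x)
    (by rw [← norm_pow, ← map_pow, hx, map_ofNat, WildDyadic.norm_two])
  rwa [absRamificationIdx_rescaledCompletion] at h

/-- **`F = ℚ[X]/(g)`, `g` an irreducible factor of `X⁴ − c`** (`c = 2, 3`): a number field of degree `≤ 4`
with `α⁴ = c`. [folklore] -/
theorem exists_numberField_pow_four_eq_finrank_le (c : ℕ) :
    ∃ (F : Type) (_ : Field F) (_ : NumberField F) (α : F), α ^ 4 = c ∧ Module.finrank ℚ F ≤ 4 := by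
  let f : ℚ[X] := X ^ 4 - C (c : ℚ)
  have hf : f.natDegree = 4 := natDegree_X_pow_sub_C
  have hfne : f.natDegree ≠ 0 := by rw [hf]; norm_num
  haveI : Fact (Irreducible f.factor) := ⟨irreducible_factor f⟩
  have hg0 : f.factor ≠ 0 := (irreducible_factor f).ne_zero
  haveI : Module.Finite ℚ (AdjoinRoot f.factor) := (AdjoinRoot.powerBasis hg0).finite
  haveI : CharZero (AdjoinRoot f.factor) :=
    charZero_of_injective_algebraMap (algebraMap ℚ (AdjoinRoot f.factor)).injective
  haveI : NumberField (AdjoinRoot f.factor) := NumberField.mk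
  refine ⟨AdjoinRoot f.factor, inferInstance, inferInstance, AdjoinRoot.root f.factor, ?_, ?_⟩
  · have hdvd : f.factor ∣ f := factor_dvd_of_natDegree_ne_zero hfne
    have halg : algebraMap ℚ (AdjoinRoot f.factor) = AdjoinRoot.of f.factor := Subsingleton.elim _ _
    have hroot : aeval (AdjoinRoot.root f.factor) f.factor = 0 := by
      rw [aeval_def, halg]
      exact AdjoinRoot.eval₂_root f.factor
    have h0 : aeval (AdjoinRoot.root f.factor) f = 0 := aeval_eq_zero_of_dvd_aeval_eq_zero hdvd hroot
    have h1 : aeval (AdjoinRoot.root f.factor) f = AdjoinRoot.root f.factor ^ 4 - c := by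
      simp [f, map_natCast]
    rw [h1, sub_eq_zero] at h0
    exact h0
  · rw [(AdjoinRoot.powerBasis hg0).finrank, AdjoinRoot.powerBasis_dim, ← hf]
    exact natDegree_le_of_dvd (factor_dvd_of_natDegree_ne_zero hfne)
      (monic_X_pow_sub_C (c : ℚ) (by norm_num)).ne_zero

/-- **`ℚ(⁴√3)`: a place over `2` with `(e, f) = (4, 1)` at which the honest depth-`2` (Ind3) image is
INHABITED.** [claim: Mochizuki2012, status: disputed] -/
theorem exists_numberField_quartic_dyadic_two_nonempty :
    ∃ (F : Type) (_ : Field F) (_ : NumberField F) (v : HeightOneSpectrum (𝓞 F)),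
      residueChar F v = 2 ∧ v.asIdeal.ramificationIdx ℤ = 4 ∧ v.asIdeal.inertiaDeg ℤ = 1 ∧
        (nonarchIterImage (analyticLogv F) v 2).Nonempty := by
  obtain ⟨F, _, _, α, hα, hdeg⟩ := exists_numberField_pow_four_eq_finrank_le 3
  obtain ⟨v, hv⟩ := exists_heightOneSpectrum_natCast_mem' (F := F) Nat.prime_two
  have hα' : α ^ 4 = 3 := by rw [hα]; norm_cast
  have hx : (algebraMap F (v.adicCompletion F) α) ^ 4 = 3 := by rw [← map_pow, hα', map_ofNat]
  have h4 : 4 ≤ v.asIdeal.ramificationIdx ℤ := four_le_ramificationIdx_of_pow_four_eq_three v hv _ hx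
  have hef : v.asIdeal.ramificationIdx ℤ * v.asIdeal.inertiaDeg ℤ ≤ 4 :=
    (ramificationIdx_mul_inertiaDeg_le_finrank' v).trans hdeg
  haveI := v.isPrime
  have hfpos : 0 < v.asIdeal.inertiaDeg ℤ := Ideal.inertiaDeg_pos (R := ℤ) (q := v.asIdeal)
  have he : v.asIdeal.ramificationIdx ℤ = 4 := by nlinarith
  have hf : v.asIdeal.inertiaDeg ℤ = 1 := by nlinarith
  exact ⟨F, inferInstance, inferInstance, v, residueChar_eq_of_prime_natCast_mem v Nat.prime_two hv, he, hf,
    nonarchIterImage_analyticLogv_two_nonempty_of_pow_four_eq_three v hv hα'⟩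

/-- **`ℚ(⁴√2)`: a place over `2` with `(e, f) = (4, 1)` at which EVERY honest depth-`≥ 2` (Ind3) image is
EMPTY.** [claim: Mochizuki2012, status: disputed] -/
theorem exists_numberField_quartic_dyadic_eq_empty :
    ∃ (F : Type) (_ : Field F) (_ : NumberField F) (v : HeightOneSpectrum (𝓞 F)),
      residueChar F v = 2 ∧ v.asIdeal.ramificationIdx ℤ = 4 ∧ v.asIdeal.inertiaDeg ℤ = 1 ∧
        ∀ k : ℕ, nonarchIterImage (analyticLogv F) v (k + 2) = ∅ := by
  obtain ⟨F, _, _, α, hα, hdeg⟩ := exists_numberField_pow_four_eq_finrank_le 2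
  obtain ⟨v, hv⟩ := exists_heightOneSpectrum_natCast_mem' (F := F) Nat.prime_two
  have hα' : α ^ 4 = 2 := by rw [hα]; norm_cast
  have hx : (algebraMap F (v.adicCompletion F) α) ^ 4 = 2 := by rw [← map_pow, hα', map_ofNat]
  have h4 : 4 ≤ v.asIdeal.ramificationIdx ℤ := four_le_ramificationIdx_of_pow_four_eq_two v hv _ hx
  have hef : v.asIdeal.ramificationIdx ℤ * v.asIdeal.inertiaDeg ℤ ≤ 4 :=
    (ramificationIdx_mul_inertiaDeg_le_finrank' v).trans hdeg
  haveI := v.isPrime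
  have hfpos : 0 < v.asIdeal.inertiaDeg ℤ := Ideal.inertiaDeg_pos (R := ℤ) (q := v.asIdeal)
  have he : v.asIdeal.ramificationIdx ℤ = 4 := by nlinarith
  have hf : v.asIdeal.inertiaDeg ℤ = 1 := by nlinarith
  exact ⟨F, inferInstance, inferInstance, v, residueChar_eq_of_prime_natCast_mem v Nat.prime_two hv, he, hf,
    fun k => nonarchIterImage_add_two_eq_empty_of_quartic_of_pow_four_eq_two v hv he hf hα' k⟩

/-- **THE CENSUS BIT AT `(e, f) = (4, 1)` IS NOT A FUNCTION OF `(e, f)`**: there are number fields `F₁, F₂`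
(`ℚ(⁴√2)`, `ℚ(⁴√3)`) with places `v₁, v₂` over `2`, both with `e = 4`, `f = 1`, such that the honest depth-`2`
(Ind3) iterate image is EMPTY at `v₁` and INHABITED at `v₂`. (For fields containing `√−1`, as in [IUTchI]
Def. 3.1, it IS decided: empty, §1.) [claim: Mochizuki2012, status: disputed] -/
theorem exists_quartic_dyadic_pair :
    (∃ (F : Type) (_ : Field F) (_ : NumberField F) (v : HeightOneSpectrum (𝓞 F)),
      residueChar F v = 2 ∧ v.asIdeal.ramificationIdx ℤ = 4 ∧ v.asIdeal.inertiaDeg ℤ = 1 ∧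
        nonarchIterImage (analyticLogv F) v 2 = ∅) ∧
    (∃ (F : Type) (_ : Field F) (_ : NumberField F) (v : HeightOneSpectrum (𝓞 F)),
      residueChar F v = 2 ∧ v.asIdeal.ramificationIdx ℤ = 4 ∧ v.asIdeal.inertiaDeg ℤ = 1 ∧
        (nonarchIterImage (analyticLogv F) v 2).Nonempty) := by
  refine ⟨?_, exists_numberField_quartic_dyadic_two_nonempty⟩
  obtain ⟨F, _, _, v, hp, he, hf, hall⟩ := exists_numberField_quartic_dyadic_eq_empty
  exact ⟨F, inferInstance, inferInstance, v, hp, he, hf, hall 0⟩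

end Summit.ABC.IUTFork.Thm311.Real

end
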